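import Literature.MathematicalPhysics.QuantumFieldTheory.Balaban1983to89.B8Prop7TowerAxialRecord
import Literature.MathematicalPhysics.QuantumFieldTheory.Balaban1983to89.B8Ineq166OneLevelUp
import Literature.MathematicalPhysics.QuantumFieldTheory.Balaban1983to89.Node00.CarriersB8SubBP
import Literature.MathematicalPhysics.QuantumFieldTheory.Balaban1983to89.B8SockB9P3ShellModeVacuityUniv

/-!
# `Balaban1983to89.B8Prop7TowerAxialIneq145P` — [Balaban1985RegularSpaces] **PROPOSITION 7, (1.145), FOR PRINT'S TOWER-WISE AXIAL MAP ON THE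
# P-CARRIER** `B8LeafModelZd3P.zdGF3P` ∕ `zdGF3HP` (the (1.145) conclusion `avgClose` in print's p. 77 ONE-END-POINT class) **AT NESTED LAW MEMBERS**:
# the COLLAR (1.145) — the level-`j` bonds with ONE end-block in `Ω_j^{(j)}` and the other in the (1.4) collar `Ω_{j−1} ∖ Ω_j` — and the assembled
# **`B8Ineq145.Prop7RepairedC (26384(d+1)L·530d) (zdGF3P ∘ e) (toAxialTower ∘ e)`**, its `zdGF3HP` twin and the record face at NODE 00's P-pin
# `Node00.famB8OfRecordSubBP`

statement-level skeleton of published theorems with citation tags; proofs where landed; nothing here is a claim about the Yang–Mills mass gap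

T. Bałaban, *Spaces of regular gauge field configurations on a lattice and gauge fixing conditions*, Commun. Math. Phys. **99** (1985) 75–102
`[Balaban1985RegularSpaces]` ("B8"; journal page = PDF page + 74; PDF held `paper:balaban1985-cmp99-regular-spaces-gauge-fixing`): Prop. 7 (1.144)–(1.145)
p. 100, (1.139)–(1.141) p. 100, (1.3)–(1.4) p. 77 («Ω₀ ⊃ Ω₁ ⊃ … ⊃ Ω_k», «Ω_j = Bʲ(Ω_j^{(j)}), Ω_j is a sum of cubes of a size M₁Lʲη, (Lʲη)⁻¹dist(Ω_jᶜ, Ω_{j+1})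
> RM₁»), p. 77 (bond convention «at least one end-point of b belongs to Ω»), (1.33) p. 82, (1.35) p. 82, (1.66) p. 88.  [3] = T. Bałaban, *Averaging operations
for lattice gauge theories*, Commun. Math. Phys. **98** (1985) 17–51 `[Balaban1985Averaging]`: (43) p. 24 and p. 24 («this definition is local»), Prop. 2
p. 26, (69)–(71) p. 29, Prop. 7 p. 43.

## WHY THIS FILE (cell `pub-ymgap`, HUMAN RULING D-0062 ∕ D-0149; DAG node N05 = [B8]; width seat `pub-ymgap-dag-n05-w2` g2; proof lane, count-neutral)

dag-n05-d g10's P-slot knit `Thm/BalabanUVNodesN05SubBPKnitGammaPrime.b8LeafOfRecordSubBP_cutSubB_of_knit_lettersSrc_γ'` (p596490) displays the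
Proposition-7 conjunct `p7 : B8SectGH.Prop7PrintedR (famB8OfRecordSubBP θ λ.β λ.len ·) (λ.toAxial ·.1)`.  n05-w1 g0's `B8Prop7GlevZd3P` (p596459) recorded
its worth ON THE P-CARRIER: junk-satisfiable as typed ((K1)-P), honestly inhabited in the repaired `C·α₂` form on the ALL-`ℤᵈ` members ((K3)-P), and
LOCATED the open piece at a GENERAL nested law member: n05-c g6's box-form (1.145) `B8Prop7TowerAxialIneq145.avgClose_toAxialTower` (p518422) is proved
bond by bond UNDER THE BOX GUARD «`Bʲ(z) ∪ Bʲ(z + e_μ) ⊂ Ω_j`», so it does not give the P-carrier's ONE-END-POINT letter «`Bʲ(z) ⊂ Ω_j` or `Bʲ(z + e_μ) ⊂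
Ω_j`» at the COLLAR bonds — one end-block in `Ω_j^{(j)}`, the other in `Ω_{j−1} ∖ Ω_j`, where `U₀ ∈ 𝔄` is available at level `j − 1` only (cell bus
2026-08-28 n05-c g13 WORD-PROP7-NESTED, n05-w1 g0 LANDED-9: «if you … type that collar lemma, `prop7RepairedC_zdGF3P_toAxialTower` at all law members is
a 20-line sequel»).  THIS FILE types the collar lemma and the sequel, BY NAME, from two landed kernel theorems (names suffixed `_oneUp` = the
proof route «one averaging level up»; the unsuffixed names are LEFT to n05-w1 g0's announced DIRECT collar edition `B8Prop7TowerAxialCollarP` — INTENT-10,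
cell bus 2026-08-28 02:23Z, constant `530d·L`, threshold `c(d,L)∕L²` — which re-runs n05-c's `bond_facts` one level down; the two editions differ in
constant and threshold only):
* n05-c g6's `avgClose_toAxialTower` — the box-form closeness `|(U′U₀)‾ʲ_b − Ū₀ʲ_b| ≤ 530d·α₂` at EVERY level `j ≤ k` and EVERY `j`-bond whose
  two-block box lies in `Ω_j`, for print's map `U′U₀ = (U₁U₀)^{u}`, `u = uTower`;
* this seat's lineage bridge `B8Ineq166OneLevelUp.avgClose_predBox_of_boxForm` (n05-w2 g0, p584176) — [3] (43) «ONE averaging level up»: `Ūʲ(c)` reads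
  only the level-`(j−1)` averages over the sub-boxes of `box_j(c)`, and the one-step average is Lipschitz at a (1.33)-regular base ([3] Prop. 2 ∕ Prop. 7),
  so box-form closeness at ALL levels + (1.33) `U₀ ∈ 𝔄_k({Ω_j}, α₀)` ⇒ closeness ×`26384(d+1)L` at every `j`-bond whose box lies in `Ω_{j−1}`;
under the DISPLAYED member hypothesis that print's (1.4) p. 77 collar supplies and the typed index `B8LeafModelZd.ZdIdx` does not carry:
«the two-block box of a level-`j` bond with an end-block in `Ω_j` lies in `Ω_{j−1}`» (`Ω_{−1} := Ω_0`; every all-`ℤᵈ` member satisfies it — §1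
`collar_of_univ` — and so does print's NESTED tower `(T, □₁, …, □_k)` of (1.131) with `ρ = R₁M₁ ≥ L` — §1 `collar_cubeFam_true`, a lawful member of the
sub-index of record: `exists_idxB8SubB_collar_topCube`, the nested A6 witness; print's `(Lʲη)⁻¹dist(Ω_{j−1}ᶜ, Ω_j) > RM₁` gives it for his sequences (1.3)–(1.4)).

## WHAT IS PROVED (kernel, 0 sorry; theorems only; `𝔸` a non-trivial C⋆-algebra, `d ≥ 2`, `L ≥ 2`)

* §1 `collar_of_univ` — the collar hypothesis at a member with `Ω_j = ℤᵈ` for all `j`; ★ `collar_cubeFam_true` — it holds on print's NESTED tower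
  `(T, □₁, …, □_k)` for `ρ ≥ L` (one `j`-block of collar between `□_{j−1}` and `□_j`, p. 98); `exists_idxB8SubB_collar_topCube` — A6, NESTED: the collar
  sub-family of `IdxB8SubB θ` contains that tower at every depth `k ≥ 1` (lawful by n05-c's `exists_topCube_member_lawsB`).
* §2 ★★ `avgClose_zdGF3P_toAxialTower_oneUp` — **THE COLLAR (1.145)**: at a member `i` of NODE 00's carrier with `Ω₀ = ℤᵈ` and the collar hypothesis, for
  `0 < α₀, α₂ ≤ c(d, L)` (r05 g7's `B8Prop7AdmittedFamily.cst`) with `530d·α₂ ≤ 1∕(12288(d+1)L)`, and every datum with (1.139) `InA α₀ U₀`, (1.140)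
  `C140 α₂ U₀ P`: `(zdGF3P 𝔸 L β len i).avgClose (26384(d+1)L·(530d·α₂)) U₀ (toAxialTower … i U₀ P)` — (1.145) IN PRINT'S ONE-END-POINT LETTER at every
  `j ≤ k`, for print's tower-wise map.
* §3 ★★ `prop7RepairedC_zdGF3P_toAxialTower_oneUp` — `B8Ineq145.Prop7RepairedC (26384(d+1)L·530d) (zdGF3P ∘ e) (toAxialTower ∘ e)` for EVERY index map
  `e : J → ZdIdx d L` into members with `Ω₀ = ℤᵈ`, NODE 00's law №8 (`trunc_lt` ∕ `trunc_top`, for the (1.144) clause — n05-c's `inAAx_toAxialTower_of_laws`,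
  `rfl`-equal fields) and the collar hypothesis; threshold `min (c(d,L)) (1∕(6512640·d·(d+1)·L))`; `prop7RepairedC_zdGF3HP_toAxialTower_oneUp` (Theorem 8's
  source space as printed: the Prop-7 letters are `zdGF3P`'s by `rfl`).
* §4 ★ `prop7RepairedC_famB8OfRecordSubBP_oneUp` — the record face: over the collar sub-family of n05-c's four-law sub-index `IdxB8SubB θ` at n05-w1's P-pin
  `Node00.famB8OfRecordSubBP θ β len` with n05-c's pin `B8Prop7TowerAxialRecord.toAxialTowerResid` of `ResidB8.toAxial`, `θ.D ≥ 2` — the honest instance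
  of D9b's displayed `p7` beyond the all-univ members.

## HONEST SCOPE

By-name composition of landed kernel theorems (`avgClose_toAxialTower`, `inAAx_toAxialTower_of_laws`, `avgClose_predBox_of_boxForm`, `cst_le`) + window
arithmetic; NO estimate of [Balaban1985RegularSpaces] or [3] is proved anew or asserted.  The constant `26384(d+1)L·530d` (NOT print's `2`) is the audit's
located repair `530d` (`B8Ineq145`, G-adv8-16; r05 g7) read one averaging level up through the bridge's `26384(d+1)L`; a direct collar edition of n05-c's
clamped standing data (n05-w1 g0's INTENT-10 `B8Prop7TowerAxialCollarP`) gives the sharper `530d·L` — not typed here.  The collar hypothesis is DISPLAYED, not a typed law (LOCATED: it is print's (1.4); the typed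
`ZdIdx` admits nested towers without collars, where the one-end-point (1.145) at depth `j` has no level-`(j−1)` regularity to read).  The TYPED conjunct
`B8SectGH.Prop7PrintedR` (constant `2`) is NOT claimed (n05-w1's (K1)-P: junk-satisfiable as typed); this file is the honest `C·α₂` instance for print's
map.  Count-neutral; N05 NOT discharged; no count claim (the chair's single count line is the only count); `T_η ↦ ℤᵈ`, `G = U(𝔸)`; one finite `𝕋⁴`
programme at fixed `ε`, Bałaban AS PRINTED; the Yang–Mills mass gap (Clay) is NOT proved by any of this — R4 closes the conditional finite-`𝕋⁴` rung
`BalabanLadder.UV` only; nothing continuum ∕ ℝ⁴ ∕ OS.  No `sorry`, no `def`, no `instance`, no `notation`.  Unit `pub-ymgap-dag-n05-w2` (g2), 2026-08-28.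

RELATED IN THE TREE, NOT DUPLICATED: `B8Prop7TowerAxialIneq145` (n05-c g6: the box form, USED), `B8SockB9P3ShellModeVacuityUniv` (n05-c: the lawful
top-cube member, USED), `B8Eq131Cubes` ∕ `B8Eq131CubesAdmissible` (the Sect. F cube tower, USED), `B8Prop7TowerAxialRecord` (n05-c g6: the old-carrier record
faces + the pin `toAxialTowerResid`, USED), `B8Prop7GlevZd3P` (n05-w1 g0: (K1)-P ∕ (K3)-P on the P-carrier; §3 here is its located sequel), `B8Ineq166OneLevelUp`
(n05-w2 g0: the bridge, USED), `B8LeafModelZd3P` ∕ `Node00.CarriersB8SubBP` (n05-w1 g0: the P-carrier and its pin, USED).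

[cite: Balaban1985RegularSpaces, Prop. 7 (1.144)–(1.145) p.100, (1.139)–(1.141) p.100, (1.3)–(1.4) p.77, p.77, (1.33) p.82, (1.35) p.82, (1.66) p.88;
Balaban1985Averaging, (43) p.24, Prop. 2 p.26, (69)–(71) p.29, Prop. 7 p.43]
-/

noncomputable section

open NormedSpace

namespace Literature.MathematicalPhysics.QuantumFieldTheory.Balaban1983to89.B8Prop7TowerAxialIneq145P

open B7Prop1Explicit B7Prop2Explicit B7Prop1Local
open B7Prop2Explicit (C0 c2' C0_pos)
open B8Lemma1NonAbelian (mulCfg)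
open B8Prop7AdmittedFamily (cst cst_pos)
open B8Prop7TowerAxialUnitary (cst_le inAAx_toAxialTower_of_laws)
open B8Prop7TowerAxialIneq145 (avgClose_toAxialTower)
open B8Prop7TowerAxialZd3 (toAxialTower)
open B8Prop7TowerAxialRecord (toAxialTowerResid)
open B8Ineq166OneLevelUp (avgClose_predBox_of_boxForm)
open B8LeafModelZd (ZdIdx)
open B8LeafModelZd3 (zdGF3)
open B8LeafModelZd3P (zdGF3P zdGF3HP EndBlockIn)
open B8IdxB8LawsB (IdxB8SubB)
open Node00 (famB8OfRecordSubBP)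
open B8Ineq130 (tlo thi tlo_apply thi_apply)
open B8Eq131Cubes (cube cube_eq bLo bHi gs margin_succ)
open B8Eq131CubesAdmissible (cubeFam cubeFam_true_zero cubeFam_of_pos)
open B8SockB9P3ShellModeVacuityUniv (exists_topCube_member_lawsB)

-- `Site` alone could resolve to the torus sites of `Setup.lean`; re-export the `ℤ^d` sites of `B7Prop1Explicit`.
export B7Prop1Explicit (Site)

variable {d : ℕ}

/-! ## §1 The collar hypothesis (print's (1.4) p. 77) and its all-`ℤᵈ` witness -/

section Collar

variable {L : ℕ}

/-- **A6 WITNESS FOR THE DISPLAYED COLLAR HYPOTHESIS**: at a member whose regions are all of `ℤᵈ` («we admit Ω_j = T_η», p. 77) the two-block box of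
ANY level-`j` bond lies in `Ω_{j−1} = ℤᵈ` — the collar hypothesis of §2–§4 holds trivially (so those theorems are not vacuous; on these members §3 is
n05-w1's (K3)-P up to the constant). [cite: Balaban1985RegularSpaces, p.77 («we admit Ω_j = T_η»), (1.4) p.77] -/
theorem collar_of_univ (i : ZdIdx d L) (hΩ : ∀ j, i.Ω j = Set.univ) :
    ∀ j, j ≤ i.k → ∀ (z : Site d) (μ : Fin d), EndBlockIn L (i.Ω j) j z μ →
      ∀ x, InBox (loK L j z) (bondHiK L j z μ) x → x ∈ i.Ω (j - 1) := by
  intro j _ z μ _ x _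
  rw [hΩ (j - 1)]
  exact Set.mem_univ x

/-- **THE COLLAR HYPOTHESIS HOLDS ON PRINT'S OWN NESTED TOWER `(T, □₁, …, □_k)`** (Sect. F, (1.131) p. 99; `B8Eq131CubesAdmissible.cubeFam true`) whenever
the collar width `ρ = R₁M₁ ≥ L` (`L ≥ 1`): the two-block box of a level-`j` bond with an end-block in `□_j` lies in `□_{j−1}` for `2 ≤ j ≤ k` — the
boundaries of `□_{j−1} ⊃ □_j` are `ρ·Lʲ⁻¹ ≥ Lʲ` fine sites apart (`B8Eq131Cubes.margin_succ`: «a distance between boundaries of these cubes is equal to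
R₁M₁Lʲη», p. 98), one `j`-block — and in `Ω_0 = ℤᵈ` for `j ≤ 1`.  (A genuinely NESTED inhabitant of the displayed hypothesis; lattice arithmetic only.)
[cite: Balaban1985RegularSpaces, p.98 («□_j ⊃ □_{j+1} and a distance between boundaries of these cubes is equal to R₁M₁Lʲη»), (1.131) p.99, (1.4) p.77] -/
theorem collar_cubeFam_true (hL : 1 ≤ L) (a : Site d) (M : ℕ) {ρ : ℕ} (hρ : L ≤ ρ) (k : ℕ) :
    ∀ j, j ≤ k → ∀ (z : Site d) (μ : Fin d), EndBlockIn L (cubeFam true L a M ρ k j) j z μ →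
      ∀ x, InBox (loK L j z) (bondHiK L j z μ) x → x ∈ cubeFam true L a M ρ k (j - 1) := by
  intro j hj z μ hend x hx
  -- levels `0`, `1`: `Ω_{j−1} = Ω_0 = ℤᵈ`
  rcases Nat.lt_or_ge j 2 with hj2 | hj2
  · have : j - 1 = 0 := by omega
    rw [this, cubeFam_true_zero]
    exact Set.mem_univ x
  -- level `j = j' + 1 ≥ 2`: `Ω_j = □_{j'+1}`, `Ω_{j−1} = □_{j'}`, fine margins `m_{j'} = m_{j'+1} + ρL^{j'}`
  obtain ⟨j', rfl⟩ : ∃ j', j = j' + 1 := ⟨j - 1, by omega⟩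
  have hj' : 1 ≤ j' := by omega
  have hj'k : j' < k := by omega
  rw [Nat.add_sub_cancel, cubeFam_of_pos true L a M ρ hj' hj'k.le, cube_eq hj'k.le]
  rw [cubeFam_of_pos true L a M ρ (by omega) hj, cube_eq hj] at hend
  have hm := margin_succ (L := L) (ρ := ρ) hj'k
  set m₁ := L ^ (j' + 1) * (ρ * gs L (k - (j' + 1))) with hm₁
  set m₀ := L ^ j' * (ρ * gs L (k - j')) with hm₀
  have hmz : (m₀ : ℤ) = (m₁ : ℤ) + (ρ : ℤ) * (L : ℤ) ^ j' := by
    rw [hm]; push_cast; ring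
  have hL0 : (0 : ℤ) < (L : ℤ) := by exact_mod_cast hL
  have hLj : (1 : ℤ) ≤ (L : ℤ) ^ (j' + 1) := one_le_pow₀ (by exact_mod_cast hL)
  have hρL : (L : ℤ) ^ (j' + 1) ≤ (ρ : ℤ) * (L : ℤ) ^ j' := by
    rw [pow_succ, mul_comm]
    have : (L : ℤ) ≤ (ρ : ℤ) := by exact_mod_cast hρ
    exact mul_le_mul_of_nonneg_right this (by positivity)
  -- the corners of a `j`-block lie in the block
  have hcorner : ∀ w : Site d, InBox (tlo L w (j' + 1)) (thi L w (j' + 1)) (tlo L w (j' + 1)) ∧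
      InBox (tlo L w (j' + 1)) (thi L w (j' + 1)) (thi L w (j' + 1)) := by
    intro w
    constructor
    · intro i; rw [tlo_apply, thi_apply]; constructor <;> nlinarith
    · intro i; rw [tlo_apply, thi_apply]; constructor <;> nlinarith
  show InBox _ _ x
  intro i
  obtain ⟨hx1, hx2⟩ := hx i
  simp only [loK, bondHiK] at hx1 hx2
  simp only [bLo, bHi]
  rcases hend with h | h
  · -- `Bʲ(z) ⊂ □_j`: its corners bound `Lʲz`, and the far block overshoots by at most `Lʲ ≤ ρLʲ⁻¹`
    have h1 := (h _ (hcorner z).1) i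
    have h2 := (h _ (hcorner z).2) i
    rw [tlo_apply] at h1
    rw [thi_apply] at h2
    simp only [bLo, bHi] at h1 h2
    obtain ⟨h1, -⟩ := h1
    obtain ⟨-, h2⟩ := h2
    constructor
    · nlinarith
    · split_ifs at hx2 <;> nlinarith
  · -- `Bʲ(z + e_μ) ⊂ □_j`: mirrored
    have h1 := (h _ (hcorner (z + e μ)).1) i
    have h2 := (h _ (hcorner (z + e μ)).2) i
    rw [tlo_apply] at h1
    rw [thi_apply] at h2
    simp only [bLo, bHi, Pi.add_apply, e] at h1 h2
    obtain ⟨h1, -⟩ := h1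
    obtain ⟨-, h2⟩ := h2
    by_cases hi : i = μ
    · subst hi
      simp only [Pi.single_eq_same] at h1 h2
      rw [if_pos rfl] at hx2
      constructor <;> nlinarith
    · simp only [Pi.single_eq_of_ne hi, add_zero] at h1 h2
      rw [if_neg hi] at hx2
      constructor <;> nlinarith

/-- **A6, NESTED: THE COLLAR SUB-FAMILY OF THE SUB-INDEX OF RECORD `IdxB8SubB θ` CONTAINS PRINT'S NESTED TOWER `(T, □₁, …, □_k)` AT EVERY DEPTH `k ≥ 1`**
(`η = L⁻ᵏ`, `a = 0`, `M = 1`, `ρ = L`; lawful by n05-c's `exists_topCube_member_lawsB`): a member `j : IdxB8SubB θ` with `j.Ω = cubeFam true θ.L 0 1 θ.L k` —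
`Ω_2 = □_2 ≠ ℤᵈ` as soon as `k ≥ 2`, so the collar clause of §2–§4 is exercised non-trivially — satisfying the collar hypothesis.  Hence the record face §4
is not a statement about the all-univ members only. [cite: Balaban1985RegularSpaces, (1.131) p.99, (1.3)–(1.6) p.77, p.98, (1.4) p.77] -/
theorem exists_idxB8SubB_collar_topCube (θ : Node00.Stage3Params) {k : ℕ} (hk : 1 ≤ k) :
    ∃ j : IdxB8SubB θ, j.1.1.k = k ∧ j.1.1.Ω = cubeFam true θ.L 0 1 θ.L k ∧
      ∀ l, l ≤ j.1.1.k → ∀ (z : Site θ.D) (μ : Fin θ.D), EndBlockIn θ.L (j.1.1.Ω l) l z μ →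
        ∀ x, InBox (loK θ.L l z) (bondHiK θ.L l z μ) x → x ∈ j.1.1.Ω (l - 1) := by
  have hL : 1 ≤ θ.L := le_trans (by norm_num) θ.two_le_L
  have hL0 : (0 : ℝ) < θ.L := by exact_mod_cast (show 0 < θ.L by omega)
  have hη : (0 : ℝ) < ((θ.L : ℝ)⁻¹) ^ k := pow_pos (inv_pos.mpr hL0) k
  have hscale : (θ.L : ℝ) ^ k * ((θ.L : ℝ)⁻¹) ^ k ≤ 1 := by
    rw [← mul_pow, mul_inv_cancel₀ hL0.ne', one_pow]
  obtain ⟨i, hik, -, hΩ, -, -, -, hlaws⟩ :=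
    exists_topCube_member_lawsB (d := θ.D) hL (0 : Site θ.D) 1 (le_refl θ.L) hk hη hscale
  have hΩ0 : i.Ω 0 = Set.univ := by rw [hΩ]; exact cubeFam_true_zero θ.L 0 1 θ.L k
  refine ⟨⟨⟨i, hΩ0⟩, hlaws⟩, hik, hΩ, ?_⟩
  show ∀ l, l ≤ i.k → ∀ (z : Site θ.D) (μ : Fin θ.D), EndBlockIn θ.L (i.Ω l) l z μ →
    ∀ x, InBox (loK θ.L l z) (bondHiK θ.L l z μ) x → x ∈ i.Ω (l - 1)
  rw [hik, hΩ]
  exact collar_cubeFam_true hL 0 1 (le_refl θ.L) k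

end Collar

/-! ## §2 THE COLLAR (1.145): print's one-end-point letter on the P-carrier, for print's tower-wise map -/

section Ineq145P

variable {𝔸 : Type} [CStarAlgebra 𝔸] [Nontrivial 𝔸] {L : ℕ} {β : ℝ} {len : Site d → ℝ}

/-- ★★ **THE COLLAR (1.145) — PROPOSITION 7's (1.145) IN PRINT'S ONE-END-POINT LETTER, ON THE P-CARRIER, FOR PRINT'S TOWER-WISE MAP.**  At a member
`i` of NODE 00's carrier with `Ω₀ = ℤᵈ` (`d, L ≥ 2`) whose Ω-tower obeys the collar hypothesis «the two-block box `Bʲ(z) ∪ Bʲ(z + e_μ)` of a level-`j`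
bond with an end-block in `Ω_j` lies in `Ω_{j−1}`» (print's (1.4); `hcol`), in the regime `0 < α₀, α₂ ≤ c(d, L)` with the bridge window
`530d·α₂ ≤ 1∕(12288(d+1)L)`, for every datum with (1.139) `InA α₀ U₀` and (1.140) `C140 α₂ U₀ P`:
`(zdGF3P 𝔸 L β len i).avgClose (26384(d+1)L·(530d·α₂)) U₀ (toAxialTower … i U₀ P)`, i.e. `|(U′U₀)‾ʲ(z, z+e_μ) − Ū₀ʲ(z, z+e_μ)| ≤ 26384(d+1)L·530d·α₂`
at every `j ≤ k` and every `j`-bond with `Bʲ(z) ⊂ Ω_j` OR `Bʲ(z + e_μ) ⊂ Ω_j`, `U′U₀ = (U₁U₀)^{u}`, `u = uTower`.  PROOF (by name): n05-c g6's box-form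
(1.145) `avgClose_toAxialTower` gives `530d·α₂` at every `j ≤ k` and every `j`-bond whose box lies in `Ω_j`; (1.33) `InA α₀ U₀` (`rfl`: `InAk`) and the
bridge `avgClose_predBox_of_boxForm` ([3] (43): one averaging level up, Lipschitz at a (1.33)-regular base) carry it to every `j`-bond whose box lies in
`Ω_{j−1}`, ×`26384(d+1)L`; the collar hypothesis places every one-end-point bond there.  The bridge's windows `C₀α₀ ≤ 1∕3`, `8α₀ ≤ c₂′` follow from
`α₀ ≤ c(d, L)` (`cst_le`: `α₀ ≤ 1∕(24C₀)`, `α₀ ≤ c₂′∕16`).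
[cite: Balaban1985RegularSpaces, Prop. 7 (1.145) p.100 (inequality; constant repaired: audit G-adv8-16 ∕ `B8Ineq145`, one level up), (1.4) p.77, p.77, (1.33) p.82, (1.35) p.82; Balaban1985Averaging, (43) p.24, Prop. 2 p.26, (69)–(71) p.29, Prop. 7 p.43] -/
theorem avgClose_zdGF3P_toAxialTower_oneUp (hd2 : 2 ≤ d) (hL : 2 ≤ L) (i : ZdIdx d L) (hΩ0 : i.Ω 0 = Set.univ)
    (hcol : ∀ j, j ≤ i.k → ∀ (z : Site d) (μ : Fin d), EndBlockIn L (i.Ω j) j z μ →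
      ∀ x, InBox (loK L j z) (bondHiK L j z μ) x → x ∈ i.Ω (j - 1))
    {α₀ α₂ : ℝ} (hα₀ : 0 < α₀) (hα₀c : α₀ ≤ cst d L) (hα₂ : 0 < α₂) (hα₂c : α₂ ≤ cst d L)
    (hα₂w : 530 * (d : ℝ) * α₂ ≤ 1 / (12288 * ((d : ℝ) + 1) * L))
    (U₀ : (zdGF3P 𝔸 L β len i).Cfg) (P : (zdGF3P 𝔸 L β len i).Pert)
    (hInA : (zdGF3P 𝔸 L β len i).InA α₀ U₀) (h140 : (zdGF3P 𝔸 L β len i).C140 α₂ U₀ P) :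
    (zdGF3P 𝔸 L β len i).avgClose (26384 * ((d : ℝ) + 1) * L * (530 * (d : ℝ) * α₂)) U₀
      (toAxialTower 𝔸 L β len (le_trans one_le_two hL) i U₀ P) := by
  -- n05-c g6: the box form at every level `j ≤ k`, constant `530d`
  have hbox : (zdGF3 𝔸 L β len i).avgClose (530 * (d : ℝ) * α₂) U₀
      (toAxialTower 𝔸 L β len (le_trans one_le_two hL) i U₀ P) :=
    avgClose_toAxialTower hd2 hL i hΩ0 hα₀ hα₀c hα₂ hα₂c U₀ P hInA h140
  -- the bridge's windows from `α₀ ≤ c(d, L)`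
  obtain ⟨-, h24, hc2, -, -, -, -⟩ := cst_le (d := d) hα₀c
  have hC0 := C0_pos d
  have hα3 : C0 d * α₀ ≤ 1 / 3 := by
    have e24 : C0 d * (1 / (24 * C0 d)) = 1 / 24 := by field_simp
    have h := (mul_le_mul_of_nonneg_left h24 hC0.le).trans_eq e24
    linarith
  have hα8 : 8 * α₀ ≤ c2' d L := by
    have hc2pos : 0 < c2' d L := by unfold c2'; positivity
    linarith
  have hα₁ : 0 ≤ 530 * (d : ℝ) * α₂ := by positivity
  -- (1.33) as `InAk` (`rfl`) and the box form as the bridge's `h135`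
  have h33 : B8Ineq132.InAk L i.k i.η α₀ i.Ω U₀.1 := hInA
  have h135 : ∀ j, j ≤ i.k → ∀ (z : Site d) (μ : Fin d), (∀ x, InBox (loK L j z) (bondHiK L j z μ) x → x ∈ i.Ω j) →
      ‖(avgIter L (mulCfg (toAxialTower 𝔸 L β len (le_trans one_le_two hL) i U₀ P).2.1 U₀.1) j z μ : 𝔸)
        - (avgIter L U₀.1 j z μ : 𝔸)‖ ≤ 530 * (d : ℝ) * α₂ := hbox
  have h := avgClose_predBox_of_boxForm hL U₀.2 hα₀ hα3 hα8 hα₁ hα₂w h33 h135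
  -- the one-end-point letter: the collar hypothesis places every guarded bond's box in `Ω_{j−1}`
  intro j hj z μ hend
  exact h j hj z μ (hcol j hj z μ hend)

/-- The same on the P-carrier with Theorem 8's source space as printed (`zdGF3HP`): the Prop-7 letters (`Cfg`, `Pert`, `InA`, `C140`, `avgClose`) are
`zdGF3P`'s by `rfl`, so the same proof term elaborates. [cite: Balaban1985RegularSpaces, Prop. 7 (1.145) p.100, (1.4) p.77] -/
theorem avgClose_zdGF3HP_toAxialTower_oneUp (hd2 : 2 ≤ d) (hL : 2 ≤ L) (i : ZdIdx d L) (hΩ0 : i.Ω 0 = Set.univ)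
    (hcol : ∀ j, j ≤ i.k → ∀ (z : Site d) (μ : Fin d), EndBlockIn L (i.Ω j) j z μ →
      ∀ x, InBox (loK L j z) (bondHiK L j z μ) x → x ∈ i.Ω (j - 1))
    {α₀ α₂ : ℝ} (hα₀ : 0 < α₀) (hα₀c : α₀ ≤ cst d L) (hα₂ : 0 < α₂) (hα₂c : α₂ ≤ cst d L)
    (hα₂w : 530 * (d : ℝ) * α₂ ≤ 1 / (12288 * ((d : ℝ) + 1) * L))
    (U₀ : (zdGF3HP 𝔸 L β len i).Cfg) (P : (zdGF3HP 𝔸 L β len i).Pert)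
    (hInA : (zdGF3HP 𝔸 L β len i).InA α₀ U₀) (h140 : (zdGF3HP 𝔸 L β len i).C140 α₂ U₀ P) :
    (zdGF3HP 𝔸 L β len i).avgClose (26384 * ((d : ℝ) + 1) * L * (530 * (d : ℝ) * α₂)) U₀
      (toAxialTower 𝔸 L β len (le_trans one_le_two hL) i U₀ P) :=
  avgClose_zdGF3P_toAxialTower_oneUp hd2 hL i hΩ0 hcol hα₀ hα₀c hα₂ hα₂c hα₂w U₀ P hInA h140

end Ineq145P

/-! ## §3 PROPOSITION 7 REPAIRED ON THE P-CARRIER, `B8Ineq145.Prop7RepairedC (26384(d+1)L·530d)`, for print's map, over every collar-law sub-family -/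

section Prop7P

variable (𝔸 : Type) [CStarAlgebra 𝔸] [Nontrivial 𝔸] (L : ℕ) (β : ℝ) (len : Site d → ℝ)

/-- The threshold arithmetic: `α₂ ≤ 1∕(6512640·d·(d+1)·L)` gives the bridge window `530d·α₂ ≤ 1∕(12288(d+1)L)` (`6512640 = 530·12288`; `d, L ≥ 1`).
(Private arithmetic.) [folklore] -/
private theorem bridgeWindow_of_le (hd : 1 ≤ d) (hL1 : 1 ≤ L) {α₂ : ℝ}
    (h : α₂ ≤ 1 / (6512640 * (d : ℝ) * ((d : ℝ) + 1) * L)) :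
    530 * (d : ℝ) * α₂ ≤ 1 / (12288 * ((d : ℝ) + 1) * L) := by
  have hd0 : (0 : ℝ) < d := by exact_mod_cast hd
  have hL0 : (0 : ℝ) < L := by exact_mod_cast hL1
  have e : 530 * (d : ℝ) * (1 / (6512640 * (d : ℝ) * ((d : ℝ) + 1) * L)) = 1 / (12288 * ((d : ℝ) + 1) * L) := by
    field_simp
    ring
  exact (mul_le_mul_of_nonneg_left h (by positivity)).trans_eq e

/-- ★★ **PROPOSITION 7 WITH THE REPAIRED CONSTANT `26384(d+1)L·530d`, FOR PRINT'S TOWER-WISE AXIAL MAP, ON THE P-CARRIER, AT EVERY COLLAR-LAW MEMBER** —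
`B8Ineq145.Prop7RepairedC (26384(d+1)L·530d) (zdGF3P ∘ e) (toAxialTower ∘ e)` for ANY index map `e : J → ZdIdx d L` into members with `Ω₀ = ℤᵈ` obeying
NODE 00's law №8 (`trunc_lt` ∕ `trunc_top`, VERBATIM as in n05-c's `prop7RepairedC_zdGF3_toAxialTower`) and the collar hypothesis (print's (1.4)):
«∃ c(d, L) > 0, ∀ members, ∀ 0 < α₀, α₂ ≤ c, ∀ U₀, U₁ with (1.139), (1.140): U′U₀ = (U₁U₀)^{u} ∈ 𝔄_k({Ω_j}, α₀ + 3α₂) ∩ Ax(𝔅, U₀) (1.144) and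
|(U′U₀)‾ʲ − Ū₀ʲ| ≤ 26384(d+1)L·530d·α₂ ON Ω_j^{(j)} IN PRINT'S ONE-END-POINT CLASS (1.145)», threshold `c = min (c(d,L)) (1∕(6512640·d·(d+1)·L))`.
The (1.144) clause is n05-c g6's `inAAx_toAxialTower_of_laws` (`InAAx` of `zdGF3P` is `zdGF3`'s by `rfl`); the (1.145) clause is §2.  This is the located
sequel n05-w1 g0 named («`prop7RepairedC_zdGF3P_toAxialTower` at all law members»; this is its one-level-up edition): the HONEST counterpart, at the general collar-law members of the
P-carrier, of the junk certificate `B8Prop7GlevZd3P.prop7PrintedR_zdGF3P_unitAxial_comp`; on the all-`ℤᵈ` members (collar trivial, `collar_of_univ`) it is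
(K3)-P up to the constant.  Print's `2` is NOT claimed.
[cite: Balaban1985RegularSpaces, Prop. 7 (1.144)–(1.145) p.100, (1.139)–(1.141) p.100, (1.3)–(1.4) p.77, p.77, (1.19) p.79, (1.29) p.81, (1.33)–(1.35) p.82, (1.66) p.88; Balaban1985Averaging, (43) p.24, (67)–(71) p.29, (76)–(77) pp.29–30, (87) p.31, Prop. 7 p.43] -/
theorem prop7RepairedC_zdGF3P_toAxialTower_oneUp (hd2 : 2 ≤ d) (hL : 2 ≤ L) {J : Type} (e : J → ZdIdx d L) (hΩ0 : ∀ a, (e a).Ω 0 = Set.univ)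
    (hlt : ∀ a, ∀ m, m < (e a).k → ∀ j, j < m → (e a).Λs m j = (e a).Λs (m + 1) j)
    (htop : ∀ a, ∀ m, m < (e a).k → ∀ x, x ∈ (e a).Λs m m ↔ x ∈ (e a).Λs (m + 1) m ∨ ∃ y ∈ (e a).Λs (m + 1) (m + 1),
      x ∈ Literature.MathematicalPhysics.QuantumLattice.blockSites L y)
    (hcol : ∀ a, ∀ j, j ≤ (e a).k → ∀ (z : Site d) (μ : Fin d), EndBlockIn L ((e a).Ω j) j z μ →
      ∀ x, InBox (loK L j z) (bondHiK L j z μ) x → x ∈ (e a).Ω (j - 1)) :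
    B8Ineq145.Prop7RepairedC (26384 * ((d : ℝ) + 1) * L * (530 * (d : ℝ))) (fun a : J => zdGF3P 𝔸 L β len (e a))
      (fun a => toAxialTower 𝔸 L β len (le_trans one_le_two hL) (e a)) := by
  have hd : 1 ≤ d := le_trans one_le_two hd2
  have hL1 : 1 ≤ L := le_trans one_le_two hL
  have hd0 : (0 : ℝ) < d := by exact_mod_cast hd
  have hL0 : (0 : ℝ) < L := by exact_mod_cast hL1
  refine ⟨min (cst d L) (1 / (6512640 * (d : ℝ) * ((d : ℝ) + 1) * L)), lt_min (cst_pos hd L hL1) (by positivity), ?_⟩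
  intro a α₀ α₂ hα₀ hα₀c hα₂ hα₂c U₀ P hInA h140
  have hα₀c' : α₀ ≤ cst d L := hα₀c.trans (min_le_left _ _)
  have hα₂c' : α₂ ≤ cst d L := hα₂c.trans (min_le_left _ _)
  have hα₂w : 530 * (d : ℝ) * α₂ ≤ 1 / (12288 * ((d : ℝ) + 1) * L) :=
    bridgeWindow_of_le (d := d) L hd hL1 (hα₂c.trans (min_le_right _ _))
  refine ⟨inAAx_toAxialTower_of_laws hd2 hL (e a) (hΩ0 a) (hlt a) (htop a) hα₀ hα₀c' hα₂ hα₂c' U₀ P hInA h140, ?_⟩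
  have hmul : 26384 * ((d : ℝ) + 1) * L * (530 * (d : ℝ)) * α₂ = 26384 * ((d : ℝ) + 1) * L * (530 * (d : ℝ) * α₂) := by ring
  rw [hmul]
  exact avgClose_zdGF3P_toAxialTower_oneUp hd2 hL (e a) (hΩ0 a) (hcol a) hα₀ hα₀c' hα₂ hα₂c' hα₂w U₀ P hInA h140

/-- **… on the P-carrier with Theorem 8's source space as printed** (`zdGF3HP`): Proposition 7 reads no source — the fields it reads are `zdGF3P`'s by
`rfl`, so the SAME proof term elaborates. [cite: Balaban1985RegularSpaces, Prop. 7 (1.144)–(1.145) p.100, (1.4) p.77] -/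
theorem prop7RepairedC_zdGF3HP_toAxialTower_oneUp (hd2 : 2 ≤ d) (hL : 2 ≤ L) {J : Type} (e : J → ZdIdx d L) (hΩ0 : ∀ a, (e a).Ω 0 = Set.univ)
    (hlt : ∀ a, ∀ m, m < (e a).k → ∀ j, j < m → (e a).Λs m j = (e a).Λs (m + 1) j)
    (htop : ∀ a, ∀ m, m < (e a).k → ∀ x, x ∈ (e a).Λs m m ↔ x ∈ (e a).Λs (m + 1) m ∨ ∃ y ∈ (e a).Λs (m + 1) (m + 1),
      x ∈ Literature.MathematicalPhysics.QuantumLattice.blockSites L y)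
    (hcol : ∀ a, ∀ j, j ≤ (e a).k → ∀ (z : Site d) (μ : Fin d), EndBlockIn L ((e a).Ω j) j z μ →
      ∀ x, InBox (loK L j z) (bondHiK L j z μ) x → x ∈ (e a).Ω (j - 1)) :
    B8Ineq145.Prop7RepairedC (26384 * ((d : ℝ) + 1) * L * (530 * (d : ℝ))) (fun a : J => zdGF3HP 𝔸 L β len (e a))
      (fun a => toAxialTower 𝔸 L β len (le_trans one_le_two hL) (e a)) :=
  prop7RepairedC_zdGF3P_toAxialTower_oneUp 𝔸 L β len hd2 hL e hΩ0 hlt htop hcol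

end Prop7P

/-! ## §4 The record face: the collar sub-family of NODE 00's P-pin `famB8OfRecordSubBP θ β len` over `IdxB8SubB θ` -/

section Record

open Node00

variable {θ : Stage3Params} (β : ℝ) (len : Site θ.D → ℝ)

/-- ★ **PROPOSITION 7 (repaired constant `26384(θ.D+1)θ.L·530θ.D`, print's one-end-point (1.145)) FOR PRINT'S MAP AT NODE 00's P-PIN, ON THE COLLAR
SUB-FAMILY** — over the members `j` of n05-c's four-law sub-index `IdxB8SubB θ` (`Ω₀ = ℤᵈ`, laws №7 ∕ №8 ∕ №11 ∕ №12) whose Ω-tower obeys the collar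
hypothesis (print's (1.4); displayed as the subtype's predicate), at n05-w1 g0's carrier of record `famB8OfRecordSubBP θ β len j = zdGF3HP θ.𝔸 θ.L β len j.1.1`
with n05-c g6's pin `toAxialTowerResid θ β len j.1` of the residual field `ResidB8.toAxial`, for every `θ` with `θ.D ≥ 2` (`θ.L ≥ 2` from
`Stage3Params.two_le_L`): §3 at `e := (·.1.1.1)`.  The honest instance of D9b's displayed `p7` beyond the all-univ members (n05-w1's (K3)-P); the all-univ
members belong to the sub-family (`collar_of_univ`). [cite: Balaban1985RegularSpaces, Prop. 7 (1.144)–(1.145) p.100 (constant: audit G-adv8-16 ∕ `B8Ineq145`, one level up), (1.4) p.77] -/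
theorem prop7RepairedC_famB8OfRecordSubBP_oneUp (hD : 2 ≤ θ.D) :
    B8Ineq145.Prop7RepairedC (26384 * ((θ.D : ℝ) + 1) * θ.L * (530 * (θ.D : ℝ)))
      (fun j : {j : IdxB8SubB θ // ∀ l, l ≤ j.1.1.k → ∀ (z : Site θ.D) (μ : Fin θ.D), EndBlockIn θ.L (j.1.1.Ω l) l z μ →
          ∀ x, InBox (loK θ.L l z) (bondHiK θ.L l z μ) x → x ∈ j.1.1.Ω (l - 1)} =>
        famB8OfRecordSubBP θ β len j.1)
      (fun j => toAxialTowerResid θ β len j.1.1) :=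
  prop7RepairedC_zdGF3HP_toAxialTower_oneUp θ.𝔸 θ.L β len hD θ.two_le_L
    (fun j : {j : IdxB8SubB θ // ∀ l, l ≤ j.1.1.k → ∀ (z : Site θ.D) (μ : Fin θ.D), EndBlockIn θ.L (j.1.1.Ω l) l z μ →
        ∀ x, InBox (loK θ.L l z) (bondHiK θ.L l z μ) x → x ∈ j.1.1.Ω (l - 1)} => j.1.1.1)
    (fun j => j.1.1.2) (fun j => j.1.2.toIdxB8Laws.trunc_lt) (fun j => j.1.2.toIdxB8Laws.trunc_top) (fun j => j.2)

end Record


end Literature.MathematicalPhysics.QuantumFieldTheory.Balaban1983to89.B8Prop7TowerAxialIneq145P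

end
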